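import Summits.QuantumFields.YangMills.Theorems.LuscherReductionTwistedTraceScalingBOStiffDoor
import HarnessLib

/-!
# (B-ST) flat Poincaré, step 1½: KILLED TRANSFER of a global Poincaré inequality to a window, for s-finite reference measures (Lebesgue)
# (lane A of S-BASE, crux `TwistedTraceScaling` stmt-QuantumFields-20203, C4-CORE, the (B-ST) pen; HANDOFF-g21 UPDATE 21:40Z hflat chain; cdisprove R63)

R63 (`…Negative.CensoredPoincareKilling.killed_transfer_door`) transfers a global Poincaré inequality to a window `T` at the price of a killing (mass) slack, for FINITE
measures.  The Mehler Poincaré inequality (`…MehlerPoincare.mehler_poincare_normal`) lives on Lebesgue measure; this file is the s-finite version with the integrability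
hypotheses spelled out (`J(x,·)` and `J` integrable, `D` integrable), in the shape consumed by `…BOStiffTensorPoincareSlack.variance_tensor_le_slack` on `μ.restrict T`:
★★★ `killed_transfer_sfinite` — if `Var_X^D(g) ≤ P₀·½∫∫(g x − g y)²J` for every bounded measurable `g`, `J ≥ 0` symmetric, and the exit mass `∫_{Tᶜ} J(x,y) dy ≤ ε D(x)` on `T`,
then for every bounded measurable `h`: `∫_T h²D − (∫_T hD)²/∫_T D ≤ P₀·(½∫_T∫_T (h x − h y)²J) + P₀ε·∫_T h²D`.
HONEST FRAMING: bookkeeping for a stub of a child of the CONDITIONAL route R2b1; (B-ST) OPEN; C4-CORE OPEN; not infinite volume, not a gap, not Clay.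
-/

set_option autoImplicit false

noncomputable section

open MeasureTheory

namespace Summit.QuantumFields.YangMills.Theorems.FemtoTransferGap.StiffDoor

variable {X : Type*} [MeasurableSpace X] {μ : Measure X} [SFinite μ]

section Killed

variable {J : X → X → ℝ} {D : X → ℝ} {T : Set X} {CJ P₀ ε : ℝ}

omit [SFinite μ] in
/-- Row integral of the jump integrand at a point outside the window: `∫ (g x − g y)² J(x,y) dy = ∫_T h(y)² J(x,y) dy` for `g = 𝟙_T h`, `x ∉ T`. [folklore] -/
theorem jumpRow_of_not_mem {h : X → ℝ} (hT : MeasurableSet T) {x : X} (hx : x ∉ T) :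
    ∫ y, (T.indicator h x - T.indicator h y) ^ 2 * J x y ∂μ = ∫ y in T, h y ^ 2 * J x y ∂μ := by
  rw [Set.indicator_of_notMem hx, ← integral_indicator hT]
  refine integral_congr_ae (ae_of_all _ fun y => ?_)
  dsimp only
  by_cases hy : y ∈ T
  · rw [Set.indicator_of_mem hy, Set.indicator_of_mem hy]; ring
  · rw [Set.indicator_of_notMem hy, Set.indicator_of_notMem hy]; ring

omit [SFinite μ] in
/-- Row integral inside the window: `∫ (g x − g y)² J(x,y) dy = ∫_T (h x − h y)² J(x,y) dy + h(x)² ∫_{Tᶜ} J(x,y) dy` for `g = 𝟙_T h`, `x ∈ T`. [folklore] -/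
theorem jumpRow_of_mem {h : X → ℝ} (hh : Measurable h) {Ch : ℝ} (hhb : ∀ x, |h x| ≤ Ch) (hJ : Measurable (Function.uncurry J)) (hT : MeasurableSet T) {x : X}
    (hJx : Integrable (J x) μ) (hx : x ∈ T) :
    ∫ y, (T.indicator h x - T.indicator h y) ^ 2 * J x y ∂μ = (∫ y in T, (h x - h y) ^ 2 * J x y ∂μ) + h x ^ 2 * ∫ y in Tᶜ, J x y ∂μ := by
  have hJxm : Measurable (J x) := hJ.comp (measurable_const.prodMk measurable_id)
  have hF : Integrable (fun y => (T.indicator h x - T.indicator h y) ^ 2 * J x y) μ := by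
    refine (hJx.norm.const_mul ((Ch + Ch) ^ 2)).mono' ((((measurable_const.sub (hh.indicator hT)).pow_const 2).mul hJxm).aestronglyMeasurable)
      (ae_of_all _ fun y => ?_)
    rw [Real.norm_eq_abs, abs_mul, abs_pow, Real.norm_eq_abs]
    refine mul_le_mul_of_nonneg_right (pow_le_pow_left₀ (abs_nonneg _) ((abs_sub _ _).trans (add_le_add ?_ ?_)) 2) (abs_nonneg _)
    · exact (norm_indicator_le_norm_self (s := T) h x).trans (by rw [Real.norm_eq_abs]; exact hhb x)
    · exact (norm_indicator_le_norm_self (s := T) h y).trans (by rw [Real.norm_eq_abs]; exact hhb y)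
  rw [← integral_add_compl hT hF, Set.indicator_of_mem hx]
  congr 1
  · refine setIntegral_congr_fun hT fun y hy => ?_
    rw [Set.indicator_of_mem hy]
  · rw [← integral_const_mul]
    refine setIntegral_congr_fun hT.compl fun y hy => ?_
    rw [Set.indicator_of_notMem hy]; ring

/-- ★★★ **Killed transfer, s-finite version.**  See the module docstring. [folklore] -/
theorem killed_transfer_sfinite (hJ : Measurable (Function.uncurry J)) (hJ0 : ∀ x y, 0 ≤ J x y) (hsymm : ∀ x y, J x y = J y x)
    (hJx : ∀ x, Integrable (J x) μ) (hJint : Integrable (Function.uncurry J) (μ.prod μ))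
    (hD : Measurable D) (hD0 : ∀ x, 0 ≤ D x) (hDint : Integrable D μ) (hT : MeasurableSet T) (hZT : 0 < ∫ x in T, D x ∂μ) (hP₀ : 0 ≤ P₀)
    (hκ : ∀ x ∈ T, ∫ y in Tᶜ, J x y ∂μ ≤ ε * D x)
    (hglob : ∀ g : X → ℝ, Measurable g → (∃ C : ℝ, ∀ x, |g x| ≤ C) →
      (∫ x, g x ^ 2 * D x ∂μ) - (∫ x, g x * D x ∂μ) ^ 2 / (∫ x, D x ∂μ) ≤ P₀ * ((1 / 2) * ∫ x, ∫ y, (g x - g y) ^ 2 * J x y ∂μ ∂μ))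
    {h : X → ℝ} (hh : Measurable h) {Ch : ℝ} (hhb : ∀ x, |h x| ≤ Ch) :
    (∫ x in T, h x ^ 2 * D x ∂μ) - (∫ x in T, h x * D x ∂μ) ^ 2 / (∫ x in T, D x ∂μ) ≤
      P₀ * ((1 / 2) * ∫ x in T, ∫ y in T, (h x - h y) ^ 2 * J x y ∂μ ∂μ) + P₀ * ε * ∫ x in T, h x ^ 2 * D x ∂μ := by
  have hCh : ∀ x, 0 ≤ Ch := fun x => (abs_nonneg _).trans (hhb x)
  set g := T.indicator h with hgdef
  have hg : Measurable g := hh.indicator hT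
  have hgb : ∀ x, |g x| ≤ Ch := fun x => by
    have := norm_indicator_le_norm_self (s := T) h x; rw [Real.norm_eq_abs, Real.norm_eq_abs] at this; exact this.trans (hhb x)
  -- global Poincaré for `g`
  have hG := hglob g hg ⟨Ch, hgb⟩
  -- `∫ g²D = ∫_T h²D`, `∫ gD = ∫_T hD`
  have e1 : ∫ x, g x ^ 2 * D x ∂μ = ∫ x in T, h x ^ 2 * D x ∂μ := by
    rw [← integral_indicator hT]
    refine integral_congr_ae (ae_of_all _ fun x => ?_); dsimp only
    by_cases hx : x ∈ T
    · rw [hgdef, Set.indicator_of_mem hx, Set.indicator_of_mem hx]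
    · rw [hgdef, Set.indicator_of_notMem hx, Set.indicator_of_notMem hx]; ring
  have e2 : ∫ x, g x * D x ∂μ = ∫ x in T, h x * D x ∂μ := by
    rw [← integral_indicator hT]
    refine integral_congr_ae (ae_of_all _ fun x => ?_); dsimp only
    by_cases hx : x ∈ T
    · rw [hgdef, Set.indicator_of_mem hx, Set.indicator_of_mem hx]
    · rw [hgdef, Set.indicator_of_notMem hx, Set.indicator_of_notMem hx]; ring
  -- `Var_T(h) ≤ Var_X(g)` since `∫_T D ≤ ∫ D`
  have hZX : ∫ x in T, D x ∂μ ≤ ∫ x, D x ∂μ := setIntegral_le_integral hDint (ae_of_all _ hD0)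
  have hZX0 : 0 < ∫ x, D x ∂μ := hZT.trans_le hZX
  have hVar : (∫ x in T, h x ^ 2 * D x ∂μ) - (∫ x in T, h x * D x ∂μ) ^ 2 / (∫ x in T, D x ∂μ) ≤
      (∫ x, g x ^ 2 * D x ∂μ) - (∫ x, g x * D x ∂μ) ^ 2 / (∫ x, D x ∂μ) := by
    rw [e1, e2]
    have : (∫ x in T, h x * D x ∂μ) ^ 2 / (∫ x, D x ∂μ) ≤ (∫ x in T, h x * D x ∂μ) ^ 2 / (∫ x in T, D x ∂μ) :=
      div_le_div_of_nonneg_left (sq_nonneg _) hZT hZX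
    linarith
  -- split the global jump form along `T`/`Tᶜ` in the outer variable
  have hrow_int : Integrable (fun x => ∫ y, (g x - g y) ^ 2 * J x y ∂μ) μ := by
    have hF : Integrable (fun p : X × X => (g p.1 - g p.2) ^ 2 * J p.1 p.2) (μ.prod μ) := by
      refine (hJint.norm.const_mul ((Ch + Ch) ^ 2)).mono' ((((hg.comp measurable_fst).sub (hg.comp measurable_snd)).pow_const 2).mul hJ).aestronglyMeasurable
        (ae_of_all _ fun p => ?_)
      rw [Real.norm_eq_abs, abs_mul, abs_pow, Real.norm_eq_abs]
      exact mul_le_mul_of_nonneg_right (pow_le_pow_left₀ (abs_nonneg _) ((abs_sub _ _).trans (add_le_add (hgb _) (hgb _))) 2) (abs_nonneg _)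
    exact hF.integral_prod_left
  have hsplit : ∫ x, ∫ y, (g x - g y) ^ 2 * J x y ∂μ ∂μ =
      (∫ x in T, ((∫ y in T, (h x - h y) ^ 2 * J x y ∂μ) + h x ^ 2 * ∫ y in Tᶜ, J x y ∂μ) ∂μ) + ∫ x in Tᶜ, ∫ y in T, h y ^ 2 * J x y ∂μ ∂μ := by
    rw [← integral_add_compl hT hrow_int]
    congr 1
    · exact setIntegral_congr_fun hT fun x hx => jumpRow_of_mem (μ := μ) hh hhb hJ hT (hJx x) hx
    · exact setIntegral_congr_fun hT.compl fun x hx => jumpRow_of_not_mem (μ := μ) hT hx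
  -- the outside rows are the killing term by symmetry: `∫_{Tᶜ}∫_T h(y)²J(x,y) = ∫_T h(y)² ∫_{Tᶜ} J(y,x) dx ≤ ε ∫_T h²D`
  have hK1 : ∫ x in Tᶜ, ∫ y in T, h y ^ 2 * J x y ∂μ ∂μ = ∫ y in T, h y ^ 2 * ∫ x in Tᶜ, J y x ∂μ ∂μ := by
    have hF : Integrable (fun p : X × X => h p.2 ^ 2 * J p.1 p.2) ((μ.restrict Tᶜ).prod (μ.restrict T)) := by
      have hJ' : Integrable (Function.uncurry J) ((μ.restrict Tᶜ).prod (μ.restrict T)) :=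
        hJint.mono_measure (Measure.prod_mono Measure.restrict_le_self Measure.restrict_le_self)
      refine (hJ'.norm.const_mul (Ch ^ 2)).mono' ((((hh.comp measurable_snd).pow_const 2).mul hJ).aestronglyMeasurable) (ae_of_all _ fun p => ?_)
      rw [Real.norm_eq_abs, abs_mul, abs_pow, Real.norm_eq_abs]
      exact mul_le_mul_of_nonneg_right (pow_le_pow_left₀ (abs_nonneg _) (hhb _) 2) (abs_nonneg _)
    rw [integral_integral_swap hF]
    refine integral_congr_ae (ae_of_all _ fun y => ?_); dsimp only
    rw [← integral_const_mul]
    refine integral_congr_ae (ae_of_all _ fun x => ?_); dsimp only; rw [hsymm x y]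
  have iT1 : Integrable (fun y => h y ^ 2 * D y) (μ.restrict T) := by
    refine ((hDint.mono_measure Measure.restrict_le_self).norm.const_mul (Ch ^ 2)).mono' (((hh.pow_const 2).mul hD).aestronglyMeasurable) (ae_of_all _ fun y => ?_)
    rw [Real.norm_eq_abs, abs_mul, abs_pow, Real.norm_eq_abs]
    exact mul_le_mul_of_nonneg_right (pow_le_pow_left₀ (abs_nonneg _) (hhb _) 2) (abs_nonneg _)
  have hkill : ∀ y ∈ T, h y ^ 2 * ∫ x in Tᶜ, J y x ∂μ ≤ ε * (h y ^ 2 * D y) := fun y hy => by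
    have := mul_le_mul_of_nonneg_left (hκ y hy) (sq_nonneg (h y)); linarith
  have iK : Integrable (fun y => h y ^ 2 * ∫ x in Tᶜ, J y x ∂μ) (μ.restrict T) := by
    refine (iT1.const_mul ε).mono' ?_ ?_
    · have hm : Measurable fun y => ∫ x in Tᶜ, J y x ∂μ :=
        ((hJ.stronglyMeasurable.integral_prod_right' (ν := μ.restrict Tᶜ))).measurable
      exact ((hh.pow_const 2).mul hm).aestronglyMeasurable
    · refine (ae_restrict_iff' hT).2 (ae_of_all _ fun y hy => ?_)
      have h0 : 0 ≤ h y ^ 2 * ∫ x in Tᶜ, J y x ∂μ := mul_nonneg (sq_nonneg _) (integral_nonneg fun x => hJ0 y x)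
      rw [Real.norm_eq_abs, abs_of_nonneg h0]
      exact hkill y hy
  have hK2 : ∫ y in T, h y ^ 2 * ∫ x in Tᶜ, J y x ∂μ ∂μ ≤ ε * ∫ y in T, h y ^ 2 * D y ∂μ := by
    rw [← integral_const_mul]
    refine setIntegral_mono_on iK (iT1.const_mul ε) hT fun y hy => hkill y hy
  -- the inside rows
  have iIn : Integrable (fun x => ∫ y in T, (h x - h y) ^ 2 * J x y ∂μ) (μ.restrict T) := by
    have hF : Integrable (fun p : X × X => (h p.1 - h p.2) ^ 2 * J p.1 p.2) ((μ.restrict T).prod (μ.restrict T)) := by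
      have hJ' : Integrable (Function.uncurry J) ((μ.restrict T).prod (μ.restrict T)) :=
        hJint.mono_measure (Measure.prod_mono Measure.restrict_le_self Measure.restrict_le_self)
      refine (hJ'.norm.const_mul ((Ch + Ch) ^ 2)).mono' ((((hh.comp measurable_fst).sub (hh.comp measurable_snd)).pow_const 2).mul hJ).aestronglyMeasurable
        (ae_of_all _ fun p => ?_)
      rw [Real.norm_eq_abs, abs_mul, abs_pow, Real.norm_eq_abs]
      exact mul_le_mul_of_nonneg_right (pow_le_pow_left₀ (abs_nonneg _) ((abs_sub _ _).trans (add_le_add (hhb _) (hhb _))) 2) (abs_nonneg _)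
    exact hF.integral_prod_left
  have esym : (fun x => h x ^ 2 * ∫ y in Tᶜ, J x y ∂μ) = fun y => h y ^ 2 * ∫ x in Tᶜ, J y x ∂μ := by
    funext x; rfl
  have iK' : Integrable (fun x => h x ^ 2 * ∫ y in Tᶜ, J x y ∂μ) (μ.restrict T) := by rw [esym]; exact iK
  have hkill' : ∫ x in T, h x ^ 2 * ∫ y in Tᶜ, J x y ∂μ ∂μ ≤ ε * ∫ x in T, h x ^ 2 * D x ∂μ := by
    have e : ∫ x in T, h x ^ 2 * ∫ y in Tᶜ, J x y ∂μ ∂μ = ∫ y in T, h y ^ 2 * ∫ x in Tᶜ, J y x ∂μ ∂μ := by rw [esym]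
    rw [e]; exact hK2
  -- assemble
  have htotal : ∫ x, ∫ y, (g x - g y) ^ 2 * J x y ∂μ ∂μ ≤ (∫ x in T, ∫ y in T, (h x - h y) ^ 2 * J x y ∂μ ∂μ) + 2 * (ε * ∫ x in T, h x ^ 2 * D x ∂μ) := by
    rw [hsplit, integral_add iIn iK', hK1]
    linarith [hK2, hkill']
  have hfin := hVar.trans hG
  have hmono := mul_le_mul_of_nonneg_left (mul_le_mul_of_nonneg_left htotal (by norm_num : (0 : ℝ) ≤ 1 / 2)) hP₀
  linarith [hfin, hmono]

end Killed

end Summit.QuantumFields.YangMills.Theorems.FemtoTransferGap.StiffDoor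

end
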